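import Mathlib.Analysis.PSeries
import Literature.NumberTheory.LFunctions.SelbergFujiiGapMoment
import HarnessLib

/-!
# A three-range summation lemma (the split (76) of Mauduit–Rivat 2015; proved)

Everything in this file is PROVED. The elementary real-variable bookkeeping behind the split
`1 < R ≤ q^{2ρ} < q^{μ₂−μ₀} < H` of C. Mauduit, J. Rivat, J. Eur. Math. Soc. 17 (2015), (76)
and the three estimates (80), (82), (83): for nonnegative `W, R : ℤ → ℝ` with
`W ≤ M` everywhere, `W(a) ≤ K₂/(2|a|r)` for `a ≠ 0`, `W(a) ≤ (K'/(2|a|))² K₂/(2|a|r)` for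
`|a| ≥ K'`, block sums `∑_{a₀ ≤ a < a₀+K'} R(a) ≤ RB` and short sum `∑_{|a|≤T} R(a) ≤ RS`,

  `∑_{|a|<H} W(a) R(a) ≤ M·RS + K₂ RB/(T r) + K₂ RB/(K' r)`   (`sum_three_ranges_le`).

## References
* C. Mauduit, J. Rivat, J. Eur. Math. Soc. 17 (2015), §6.4.1 ((76), (80), (82), (83)). [MauduitRivat2015]
-/

noncomputable section

open Finset

namespace Literature.NumberTheory.LFunctions.MauduitRivat

/-- `∑_{1 ≤ i < I} 1/i² ≤ 2`. [folklore] -/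
theorem sum_Ico_one_inv_sq_le_two (I : ℕ) : ∑ i ∈ Ico 1 I, ((i : ℝ) ^ 2)⁻¹ ≤ 2 := by
  rcases le_or_gt I 1 with h | h
  · rw [Ico_eq_empty_of_le h, sum_empty]; norm_num
  have hsplit : Ico 1 I = insert 1 (Ioo 1 I) := by
    ext i; simp only [mem_Ico, mem_insert, mem_Ioo]; omega
  rw [hsplit, sum_insert (by simp)]
  have := sum_Ioo_inv_sq_le (α := ℝ) 1 I
  norm_num at this ⊢
  linarith

/-- `∑_{s ∪ t} g ≤ ∑_s g + ∑_t g` for nonnegative `g`. [folklore] -/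
theorem sum_union_le_TR {κ : Type*} [DecidableEq κ] (s t : Finset κ) {g : κ → ℝ} (hg : ∀ x, 0 ≤ g x) :
    ∑ x ∈ s ∪ t, g x ≤ ∑ x ∈ s, g x + ∑ x ∈ t, g x := by
  have hu := Finset.sum_union_inter (s₁ := s) (s₂ := t) (f := g)
  have hi : 0 ≤ ∑ x ∈ s ∩ t, g x := Finset.sum_nonneg fun x _ ↦ hg x
  linarith

/-- **The three ranges.** [cite: MauduitRivat2015, (76), (80), (82), (83)] -/
theorem sum_three_ranges_le {K' T H r : ℕ} (hK' : 0 < K') (hT : 1 ≤ T) (hr : 1 ≤ r)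
    {K₂ M : ℝ} (hK₂ : 0 ≤ K₂) (hM : 0 ≤ M) (W R : ℤ → ℝ) (hW0 : ∀ a, 0 ≤ W a)
    (hR0 : ∀ a, 0 ≤ R a) (hW1 : ∀ a, W a ≤ M)
    (hW2 : ∀ a : ℤ, a ≠ 0 → W a ≤ K₂ / (2 * |(a : ℝ)| * r))
    (hW3 : ∀ a : ℤ, (K' : ℤ) ≤ |a| → W a ≤ ((K' : ℝ) / (2 * |(a : ℝ)|)) ^ 2 * (K₂ / (2 * |(a : ℝ)| * r)))
    {RB RS : ℝ} (hRB : ∀ a₀ : ℤ, ∑ a ∈ Ico a₀ (a₀ + K'), R a ≤ RB)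
    (hRS : ∑ a ∈ Icc (-(T : ℤ)) T, R a ≤ RS) :
    ∑ a ∈ Ioo (-(H : ℤ)) H, W a * R a ≤ M * RS + K₂ * RB / (T * r) + K₂ * RB / (K' * r) := by
  have hRB0 : 0 ≤ RB := le_trans (sum_nonneg fun a _ => hR0 a) (hRB 0)
  have hK'R : (0 : ℝ) < K' := by exact_mod_cast hK'
  have hTR : (1 : ℝ) ≤ T := by exact_mod_cast hT
  have hrR : (1 : ℝ) ≤ r := by exact_mod_cast hr
  set S := Ioo (-(H : ℤ)) H with hS
  have hg0 : ∀ a, 0 ≤ W a * R a := fun a => mul_nonneg (hW0 a) (hR0 a)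
  -- split off `|a| ≤ T`
  rw [← sum_filter_add_sum_filter_not S (fun a : ℤ => |a| ≤ T)]
  have h1 : ∑ a ∈ S.filter (fun a : ℤ => |a| ≤ T), W a * R a ≤ M * RS := by
    calc ∑ a ∈ S.filter (fun a : ℤ => |a| ≤ T), W a * R a
        ≤ ∑ a ∈ S.filter (fun a : ℤ => |a| ≤ T), M * R a :=
          sum_le_sum fun a _ => mul_le_mul_of_nonneg_right (hW1 a) (hR0 a)
      _ ≤ ∑ a ∈ Icc (-(T : ℤ)) T, M * R a := by
          refine sum_le_sum_of_subset_of_nonneg (fun a ha => ?_) (fun _ _ _ => mul_nonneg hM (hR0 _))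
          rw [mem_filter] at ha
          rw [mem_Icc]; exact abs_le.1 ha.2
      _ ≤ M * RS := by rw [← mul_sum]; exact mul_le_mul_of_nonneg_left hRS hM
  -- split the rest at `|a| < K'`
  rw [← sum_filter_add_sum_filter_not (S.filter (fun a : ℤ => ¬ |a| ≤ T)) (fun a : ℤ => |a| < K')]
  have h2 : ∑ a ∈ (S.filter (fun a : ℤ => ¬ |a| ≤ T)).filter (fun a : ℤ => |a| < K'), W a * R a ≤
      K₂ * RB / (T * r) := by
    have hwt : ∀ a ∈ (S.filter (fun a : ℤ => ¬ |a| ≤ T)).filter (fun a : ℤ => |a| < K'),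
        W a * R a ≤ K₂ / (2 * T * r) * R a := by
      intro a ha
      simp only [mem_filter, not_le] at ha
      have hTa : (T : ℤ) < |a| := ha.1.2
      have ha0 : a ≠ 0 := by
        intro h
        rw [h, abs_zero] at hTa
        have h1T : (1 : ℤ) ≤ T := by exact_mod_cast hT
        omega
      refine mul_le_mul_of_nonneg_right ((hW2 a ha0).trans ?_) (hR0 a)
      have haR : (T : ℝ) < |(a : ℝ)| := by
        rw [← Int.cast_abs]; exact_mod_cast hTa
      have hT0 : (0 : ℝ) < T := by linarith
      rw [div_le_div_iff₀ (by positivity) (by positivity)]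
      refine mul_le_mul_of_nonneg_left ?_ hK₂
      have : (T : ℝ) * r ≤ |(a : ℝ)| * r := mul_le_mul_of_nonneg_right haR.le (by linarith)
      linarith
    refine (sum_le_sum hwt).trans ?_
    rw [← mul_sum]
    have hsub : (S.filter (fun a : ℤ => ¬ |a| ≤ T)).filter (fun a : ℤ => |a| < K') ⊆
        Ico (-(K' : ℤ)) (-(K' : ℤ) + K') ∪ Ico (0 : ℤ) (0 + K') := by
      intro a ha
      simp only [mem_filter] at ha
      have := abs_lt.1 ha.2
      simp only [mem_union, mem_Ico]
      omega
    have hs2 : ∑ a ∈ (S.filter (fun a : ℤ => ¬ |a| ≤ T)).filter (fun a : ℤ => |a| < K'), R a ≤ 2 * RB := by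
      refine (sum_le_sum_of_subset_of_nonneg hsub (fun _ _ _ => hR0 _)).trans ?_
      refine (sum_union_le_TR _ _ hR0).trans ?_
      have := hRB (-(K' : ℤ))
      have := hRB 0
      linarith
    calc K₂ / (2 * T * r) * ∑ a ∈ (S.filter (fun a : ℤ => ¬ |a| ≤ T)).filter (fun a : ℤ => |a| < K'), R a
        ≤ K₂ / (2 * T * r) * (2 * RB) := mul_le_mul_of_nonneg_left hs2 (by positivity)
      _ = K₂ * RB / (T * r) := by field_simp
  -- the range `|a| ≥ K'`: blocks
  have h3 : ∑ a ∈ (S.filter (fun a : ℤ => ¬ |a| ≤ T)).filter (fun a : ℤ => ¬ |a| < K'), W a * R a ≤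
      K₂ * RB / (K' * r) := by
    set S₃ := (S.filter (fun a : ℤ => ¬ |a| ≤ T)).filter (fun a : ℤ => ¬ |a| < K') with hS₃
    set blk : ℕ → Finset ℤ := fun i =>
      Ico ((i * K' : ℕ) : ℤ) ((i * K' : ℕ) + K') ∪ Ico (-((i * K' : ℕ) : ℤ) - K' + 1) (-((i * K' : ℕ) : ℤ) - K' + 1 + K')
      with hblk
    have hcover : S₃ ⊆ (Ico 1 (H / K' + 1)).biUnion blk := by
      intro a ha
      rw [hS₃] at ha
      simp only [mem_filter, not_le, not_lt, hS, mem_Ioo] at ha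
      obtain ⟨⟨⟨hlo, hhi⟩, _⟩, hKa⟩ := ha
      rw [mem_biUnion]
      set n := a.natAbs with hn
      have hnK : K' ≤ n := by
        have : ((K' : ℕ) : ℤ) ≤ (n : ℤ) := by rw [hn, Int.natCast_natAbs]; exact hKa
        exact_mod_cast this
      have hnH : n < H := by
        have : (n : ℤ) < H := by rw [hn, Int.natCast_natAbs]; exact abs_lt.2 ⟨hlo, hhi⟩
        exact_mod_cast this
      refine ⟨n / K', ?_, ?_⟩
      · rw [mem_Ico]
        exact ⟨(Nat.one_le_div_iff hK').2 hnK, Nat.lt_succ_of_le (Nat.div_le_div_right hnH.le)⟩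
      · have hdm := Nat.div_add_mod n K'
        have hml := Nat.mod_lt n hK'
        rw [hblk]
        simp only [mem_union, mem_Ico]
        rcases Int.natAbs_eq a with h | h
        · left
          rw [← hn] at h
          constructor
          · have : ((n / K' * K' : ℕ) : ℤ) ≤ (n : ℤ) := by exact_mod_cast (by
              rw [mul_comm]; omega)
            push_cast at this ⊢; omega
          · have : (n : ℤ) < ((n / K' * K' : ℕ) : ℤ) + K' := by
              have : n < n / K' * K' + K' := by rw [mul_comm]; omega
              exact_mod_cast this
            push_cast at this ⊢; omega
        · right
          rw [← hn] at h
          have h1 : ((n / K' * K' : ℕ) : ℤ) ≤ (n : ℤ) := by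
            exact_mod_cast (by rw [mul_comm]; omega)
          have h2 : (n : ℤ) < ((n / K' * K' : ℕ) : ℤ) + K' := by
            have : n < n / K' * K' + K' := by rw [mul_comm]; omega
            exact_mod_cast this
          push_cast at h1 h2 ⊢
          constructor <;> omega
    -- on block `i`, the weight is `≤ K₂/(8 i² K' r)`
    have hwt : ∀ i ∈ Ico 1 (H / K' + 1), ∀ a ∈ blk i,
        (if a ∈ S₃ then W a * R a else 0) ≤ K₂ / (8 * (i : ℝ) ^ 2 * K' * r) * R a := by
      intro i hi a ha
      rw [mem_Ico] at hi
      have hi1 : (1 : ℝ) ≤ i := by exact_mod_cast hi.1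
      split_ifs with hmem
      · rw [hS₃] at hmem
        simp only [mem_filter, not_lt] at hmem
        have hKa : (K' : ℤ) ≤ |a| := hmem.2
        -- `|a| ≥ i K'`
        have hia : (i : ℝ) * K' ≤ |(a : ℝ)| := by
          rw [hblk] at ha
          simp only [mem_union, mem_Ico] at ha
          have : ((i * K' : ℕ) : ℤ) ≤ |a| := by
            rcases ha with ⟨h1, _⟩ | ⟨_, h2⟩
            · exact h1.trans (le_abs_self a)
            · have : a ≤ -((i * K' : ℕ) : ℤ) := by omega
              have := neg_le_abs a
              omega
          have := (Int.cast_le (R := ℝ)).2 this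
          push_cast at this
          exact this
        have hapos : (0 : ℝ) < |(a : ℝ)| := lt_of_lt_of_le (by positivity) hia
        refine mul_le_mul_of_nonneg_right ((hW3 a hKa).trans ?_) (hR0 a)
        -- `(K'/(2|a|))² K₂/(2|a|r) ≤ K₂/(8 i² K' r)`
        rw [div_pow, div_mul_div_comm, div_le_div_iff₀ (by positivity) (by positivity)]
        have h3 : ((i : ℝ) * K') ^ 3 ≤ |(a : ℝ)| ^ 3 := by
          exact pow_le_pow_left₀ (by positivity) hia 3
        have hi3 : (i : ℝ) ^ 2 * K' ^ 3 ≤ ((i : ℝ) * K') ^ 3 := by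
          rw [mul_pow]
          refine mul_le_mul_of_nonneg_right ?_ (by positivity)
          calc (i : ℝ) ^ 2 = (i : ℝ) ^ 2 * 1 := (mul_one _).symm
            _ ≤ (i : ℝ) ^ 2 * i := mul_le_mul_of_nonneg_left hi1 (by positivity)
            _ = (i : ℝ) ^ 3 := by ring
        have h4 : (i : ℝ) ^ 2 * K' ^ 3 ≤ |(a : ℝ)| ^ 3 := hi3.trans h3
        calc (K' : ℝ) ^ 2 * K₂ * (8 * (i : ℝ) ^ 2 * K' * r) = 8 * K₂ * r * ((i : ℝ) ^ 2 * K' ^ 3) := by ring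
          _ ≤ 8 * K₂ * r * |(a : ℝ)| ^ 3 := mul_le_mul_of_nonneg_left h4 (by positivity)
          _ = _ := by ring
      · exact mul_nonneg (by positivity) (hR0 a)
    calc ∑ a ∈ S₃, W a * R a = ∑ a ∈ S₃, (if a ∈ S₃ then W a * R a else 0) :=
          sum_congr rfl fun a ha => by rw [if_pos ha]
      _ ≤ ∑ a ∈ (Ico 1 (H / K' + 1)).biUnion blk, (if a ∈ S₃ then W a * R a else 0) :=
          sum_le_sum_of_subset_of_nonneg hcover (fun a _ h => by simp [h])
      _ ≤ ∑ i ∈ Ico 1 (H / K' + 1), ∑ a ∈ blk i, (if a ∈ S₃ then W a * R a else 0) :=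
          Literature.NumberTheory.LFunctions.SelbergFujii.sum_biUnion_le_sum _ _
            (fun a => by split_ifs <;> first | exact hg0 a | exact le_rfl)
      _ ≤ ∑ i ∈ Ico 1 (H / K' + 1), ∑ a ∈ blk i, K₂ / (8 * (i : ℝ) ^ 2 * K' * r) * R a :=
          sum_le_sum fun i hi => sum_le_sum fun a ha => hwt i hi a ha
      _ ≤ ∑ i ∈ Ico 1 (H / K' + 1), K₂ / (8 * (i : ℝ) ^ 2 * K' * r) * (2 * RB) := by
          refine sum_le_sum fun i hi => ?_
          rw [← mul_sum]
          refine mul_le_mul_of_nonneg_left ?_ (by positivity)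
          rw [hblk]
          refine (sum_union_le_TR _ _ hR0).trans ?_
          have := hRB ((i * K' : ℕ) : ℤ)
          have := hRB (-((i * K' : ℕ) : ℤ) - K' + 1)
          linarith
      _ = K₂ * RB / (4 * K' * r) * ∑ i ∈ Ico 1 (H / K' + 1), ((i : ℝ) ^ 2)⁻¹ := by
          rw [mul_sum]
          refine sum_congr rfl fun i hi => ?_
          rw [mem_Ico] at hi
          have : (0 : ℝ) < i := by exact_mod_cast hi.1
          field_simp
          ring
      _ ≤ K₂ * RB / (4 * K' * r) * 2 :=
          mul_le_mul_of_nonneg_left (sum_Ico_one_inv_sq_le_two _) (by positivity)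
      _ = K₂ * RB / (K' * r) / 2 := by field_simp; ring
      _ ≤ K₂ * RB / (K' * r) := half_le_self (by positivity)
  linarith

end Literature.NumberTheory.LFunctions.MauduitRivat
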